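import Summits.KontsevichZagierPeriods.KontsevichZagierPeriods.Theses.LowDimension

/-!
# Route LowDimension — `Assembly` (item stmt-KontsevichZagierPeriods-0115)

Assembly item 0115 of route `KontsevichZagierPeriods/LowDimension`:

  `LowdimThesis → KontsevichZagierPeriods`.

`LowdimThesis` is the frame "for every `d`, any two KZ-rational integral representations of
dimensions `n, m ≤ d` with the same value are KZ-equivalent"; specialised at `d := max n m`
(`le_max_left`, `le_max_right`) it is the summit statement `KontsevichZagierPeriods`
(Kontsevich–Zagier's Conjecture 1 over the H21 calculus) itself. This implication is VERBATIM the
type of the route's kernel-checked deciding theorem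
`Summit.KontsevichZagierPeriods.KontsevichZagierPeriods.Theses.LowDimension.closes` (D-0027 §2.1;
axioms `propext`, `Classical.choice`, `Quot.sound`), so the item is `closes` read as a Prop and is
settled by that term (one-line proof, as recorded by the route review). The antecedent
`LowdimThesis` is the route's open frame and is NOT discharged here: the theorem is the implication,
nothing more. Landed by the lead seat c5 of crux stmt-KontsevichZagierPeriods-3869 (line
SketchIdeator1), whose line closed this route's crux stmt-KontsevichZagierPeriods-10622
(`LowdimBaker0DimLeOne`, d ≤ 1 by Baker).

References: M. Kontsevich, D. Zagier, *Periods* (2001), §1.2, Conjecture 1. No definitions are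
introduced.
-/

namespace Summit.KontsevichZagierPeriods.LowDimension.Assembly

/-- **Assembly of route LowDimension** (settles stmt-KontsevichZagierPeriods-0115):
`LowdimThesis → KontsevichZagierPeriods`. Given the frame (Conjecture 1 for KZ-rational
representations of dimensions `≤ d`, every `d`), two KZ-rational representations `r`, `r'` of
dimensions `n`, `m` with `r.value = r'.value` are KZ-equivalent: apply the frame at `d := max n m`.
Proof: the route's deciding theorem `closes`, whose type this is by definition of `Assembly`.
[cite: KontsevichZagier2001, §1.2 Conjecture 1] -/
theorem assembly_proof :
    Summit.KontsevichZagierPeriods.KontsevichZagierPeriods.Theses.LowDimension.Assembly :=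
  fun h => Summit.KontsevichZagierPeriods.KontsevichZagierPeriods.Theses.LowDimension.closes h

end Summit.KontsevichZagierPeriods.LowDimension.Assembly
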